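import Summits.ValiantsHypothesis.ValiantsHypothesis.Theses.RealTau
import Summits.ValiantsHypothesis.ValiantsHypothesis.Theorems.TauReal.Negative.LoadBearing
import Literature.Computability.AlgebraicComplexity.RealTauKnownCases
import Literature.LinearAlgebra.Matrix.WronskianDerivation

/-!
# Crux-strategist sketch for `RealTau.TauReal` (stmt-ValiantsHypothesis-0358) — census artefacts

Koiran's real τ-conjecture in POLYNOMIAL form,
`TauReal := ∃ c, ∀ k m t f, (t-sparse) → F ≠ 0 → #Z_ℝ(F) ≤ (k + m + t + 2) ^ c`,
`F = ∑_{i<k} ∏_{j<m} f i j`.  This file holds the typed objects referred to in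
`STRATEGY-CENSUS.md` (same directory).  Everything in §1–§3 is PROVED (no `sorry`);
§4 only TYPES the candidate statements of the census (first lemmas / rungs / sub-cruxes) as
`def … : Prop` so that they elaborate against the tree.

* §1 `pad`, `sum_prod_pad`, `card_support_pad` — the two free PADDING moves of the crux
  (new products identically `0`, new factors identically `1`).
* §2 `tauReal_of_cofinal` — **padding theorem**: the crux restricted to any regime that is
  polynomially cofinal under padding IS the crux.  Corollaries: the one-parameter DIAGONAL normal
  form `DiagTauReal ↔ TauReal` (`k = m = t = n`), and `FewProductsTauReal ↔ TauReal`
  (regime `k ≤ 2^m`).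
* §3 `realTauRefined_iff_manyProducts` — the route's rank-2 crux `RealTauRefined`
  (Tavenas' weak form `2^{a(m+1)}(k+t+2)^a`) is EXACTLY the many-products regime `2^m ≤ k` of the
  polynomial crux.  So the regime split `TauReal ↔ ManyProducts ∧ FewProducts` is degenerate
  (`FewProducts` is an alias of the whole crux) and what `TauReal` adds to `RealTauRefined` is
  precisely `m`-uniformity in the regime `k < 2^m`, where Fischer / inclusion–exclusion over the
  `m` factors is unaffordable.
* §4 typed candidates: `PosTauReal` (positive zeros), `TwoProductsOfBinomials` (the smallest open
  rung implied by the crux: `k = 2`, `t = 2`, `m → ∞`), `WronskianPairBound` (zeros of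
  `W(∏ f, ∏ g)`, the `k = 2` Rolle object), `VdPForProducts` (Voorhoeve–van der Poorten / KPT15
  Thm 8 for products of sparse polynomials — first lemma of the Wronskian transfer),
  `FlatWindowTauReal` (the "flat window" sub-crux of the log-scale decomposition),
  `HrubesSector` (Hrubeš's equivalent sector form).
-/

open Polynomial Finset
open scoped BigOperators

set_option linter.dupNamespace false

namespace Summit.ValiantsHypothesis.ValiantsHypothesis.Cruxes.TauReal.Strategist

open Summit.ValiantsHypothesis.ValiantsHypothesis.Theses.RealTau (TauReal RealTauRefined)
open Summit.ValiantsHypothesis.ValiantsHypothesis.Theorems.TauReal.Negative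
  (sum_prod_eq_zero_of_t_eq_zero card_roots_of_m_eq_zero)

noncomputable section

/-! ## §1 Padding: zero products and unit factors -/

/-- Pad an instance of shape `(k, m)` to shape `(k + a, m + b)`: every old product receives `b`
extra factors `1`, and `a` new products all of whose factors are `0`. [folklore] -/
def pad {k m : ℕ} (a b : ℕ) (f : Fin k → Fin m → ℝ[X]) : Fin (k + a) → Fin (m + b) → ℝ[X] :=
  Fin.append (fun i => Fin.append (f i) (fun _ : Fin b => (1 : ℝ[X])))
    (fun _ : Fin a => fun _ : Fin (m + b) => (0 : ℝ[X]))

theorem pad_left_left {k m : ℕ} (a b : ℕ) (f : Fin k → Fin m → ℝ[X]) (i : Fin k) (j : Fin m) :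
    pad a b f (Fin.castAdd a i) (Fin.castAdd b j) = f i j := by
  simp [pad]

theorem pad_left_right {k m : ℕ} (a b : ℕ) (f : Fin k → Fin m → ℝ[X]) (i : Fin k) (j : Fin b) :
    pad a b f (Fin.castAdd a i) (Fin.natAdd m j) = 1 := by
  simp [pad]

theorem pad_right {k m : ℕ} (a b : ℕ) (f : Fin k → Fin m → ℝ[X]) (i : Fin a) (j : Fin (m + b)) :
    pad a b f (Fin.natAdd k i) j = 0 := by
  simp [pad]

/-- Padding does not change the polynomial (as soon as there is at least one factor slot, so that
the new products are genuinely `0`). [folklore] -/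
theorem sum_prod_pad {k m : ℕ} (a b : ℕ) (hm : 0 < m + b) (f : Fin k → Fin m → ℝ[X]) :
    (∑ i, ∏ j, pad a b f i j) = ∑ i, ∏ j, f i j := by
  rw [Fin.sum_univ_add]
  have h1 : ∀ i : Fin k, (∏ j, pad a b f (Fin.castAdd a i) j) = ∏ j, f i j := by
    intro i
    rw [Fin.prod_univ_add]
    simp [pad_left_left, pad_left_right]
  have h2 : ∀ i : Fin a, (∏ j, pad a b f (Fin.natAdd k i) j) = 0 := by
    intro i
    exact Finset.prod_eq_zero (Finset.mem_univ (⟨0, hm⟩ : Fin (m + b))) (pad_right a b f i _)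
  simp [h1, h2]

/-- Padding preserves `t`-sparsity (`t ≥ 1`, so that the unit factor is allowed). [folklore] -/
theorem card_support_pad {k m t : ℕ} (a b : ℕ) (ht : 1 ≤ t) (f : Fin k → Fin m → ℝ[X])
    (hf : ∀ i j, (f i j).support.card ≤ t) : ∀ i j, (pad a b f i j).support.card ≤ t := by
  intro i j
  induction i using Fin.addCases with
  | left i =>
    induction j using Fin.addCases with
    | left j => rw [pad_left_left]; exact hf i j
    | right j =>
      rw [pad_left_right]
      have h : ((C (1 : ℝ)) * X ^ 0).support.card ≤ 1 := card_support_C_mul_X_pow_le_one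
      simp only [map_one, pow_zero, mul_one] at h
      exact h.trans ht
  | right i => rw [pad_right]; simp

/-! ## §2 The padding theorem and the diagonal / few-products normal forms -/

/-- Degenerate corner: with no factor slots, `F` is the constant `k` and has no zeros; with
`t = 0` and a factor slot, `F = 0`.  So a zero-count bound only needs `1 ≤ m` and `1 ≤ t`.
[folklore] -/
theorem card_roots_eq_zero_of_degenerate {k m t : ℕ} (f : Fin k → Fin m → ℝ[X])
    (hf : ∀ i j, (f i j).support.card ≤ t) (hF : (∑ i, ∏ j, f i j) ≠ 0) (h : m = 0 ∨ t = 0) :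
    (∑ i, ∏ j, f i j).roots.toFinset.card = 0 := by
  rcases Nat.eq_zero_or_pos m with hm | hm
  · subst hm; exact card_roots_of_m_eq_zero k f
  · rcases h with h | h
    · omega
    · subst h; exact absurd (sum_prod_eq_zero_of_t_eq_zero hm f hf) hF

/-- **Padding theorem.**  Let `Rg` be a regime of shapes `(k, m, t)` which is *polynomially
cofinal under padding*: every shape with `1 ≤ m`, `1 ≤ t` pads (more zero products, more unit
factors, larger sparsity budget) into `Rg` at polynomial cost in `k + m + t + 2`.  Then the crux
restricted to `Rg` implies the crux.  (Real-line analogue of the tree's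
`vert_le_of_regime_bound` for the Newton-polygon crux.) [folklore] -/
theorem tauReal_of_cofinal (Rg : ℕ → ℕ → ℕ → Prop) (d : ℕ)
    (hcof : ∀ k m t : ℕ, 1 ≤ m → 1 ≤ t → ∃ a b t' : ℕ, Rg (k + a) (m + b) t' ∧ t ≤ t' ∧
      (k + a) + (m + b) + t' + 2 ≤ (k + m + t + 2) ^ d)
    (hRg : ∃ c : ℕ, ∀ (k m t : ℕ) (f : Fin k → Fin m → ℝ[X]), Rg k m t →
      (∀ i j, (f i j).support.card ≤ t) → (∑ i, ∏ j, f i j) ≠ 0 →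
        (∑ i, ∏ j, f i j).roots.toFinset.card ≤ (k + m + t + 2) ^ c) :
    TauReal := by
  obtain ⟨c, hc⟩ := hRg
  refine ⟨d * c, fun k m t f hf hF => ?_⟩
  rcases Nat.eq_zero_or_pos m with hm | hm
  · rw [card_roots_eq_zero_of_degenerate f hf hF (Or.inl hm)]; exact Nat.zero_le _
  rcases Nat.eq_zero_or_pos t with ht | ht
  · rw [card_roots_eq_zero_of_degenerate f hf hF (Or.inr ht)]; exact Nat.zero_le _
  obtain ⟨a, b, t', hR, htt', hsize⟩ := hcof k m t hm ht
  have hf' : ∀ i j, (pad a b f i j).support.card ≤ t' :=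
    fun i j => (card_support_pad a b ht f hf i j).trans htt'
  have hsum := sum_prod_pad a b (by omega) f
  have h := hc (k + a) (m + b) t' (pad a b f) hR hf' (by rwa [hsum])
  rw [hsum] at h
  calc _ ≤ ((k + a) + (m + b) + t' + 2) ^ c := h
    _ ≤ ((k + m + t + 2) ^ d) ^ c := Nat.pow_le_pow_left hsize c
    _ = (k + m + t + 2) ^ (d * c) := by rw [← pow_mul]

/-- The one-parameter **diagonal normal form** of the crux: `n` products of `n` factors, each
with at most `n` monomials, at most `(n + 2)^c` distinct real zeros. [folklore] -/
def DiagTauReal : Prop :=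
  ∃ c : ℕ, ∀ (n : ℕ) (f : Fin n → Fin n → ℝ[X]), (∀ i j, (f i j).support.card ≤ n) →
    (∑ i, ∏ j, f i j) ≠ 0 → (∑ i, ∏ j, f i j).roots.toFinset.card ≤ (n + 2) ^ c

/-- The crux implies its diagonal form (instance `(n, n, n)`, `3n + 2 ≤ (n + 2)^2`). [folklore] -/
theorem diagTauReal_of_tauReal (h : TauReal) : DiagTauReal := by
  obtain ⟨c, hc⟩ := h
  refine ⟨2 * c, fun n f hf hF => (hc n n n f hf hF).trans ?_⟩
  calc (n + n + n + 2) ^ c ≤ ((n + 2) ^ 2) ^ c := Nat.pow_le_pow_left (by nlinarith) c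
    _ = (n + 2) ^ (2 * c) := by rw [← pow_mul]

/-- **The diagonal form IS the crux** (pad `(k, m, t)` to `(n, n, n)`, `n = k + m + t`).
[folklore] -/
theorem tauReal_of_diagTauReal (h : DiagTauReal) : TauReal := by
  refine tauReal_of_cofinal (fun k m t => k = m ∧ m = t) 2 ?_ ?_
  · intro k m t _ _
    refine ⟨m + t, k + t, k + m + t, ⟨by omega, by omega⟩, by omega, ?_⟩
    nlinarith
  · obtain ⟨c, hc⟩ := h
    refine ⟨c, fun k m t f hR hf hF => ?_⟩
    obtain ⟨rfl, rfl⟩ := hR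
    exact (hc k f hf hF).trans (Nat.pow_le_pow_left (by omega) c)

theorem tauReal_iff_diag : TauReal ↔ DiagTauReal :=
  ⟨diagTauReal_of_tauReal, tauReal_of_diagTauReal⟩

/-- The crux restricted to the **few-products regime** `k ≤ 2^m`. [folklore] -/
def FewProductsTauReal : Prop :=
  ∃ c : ℕ, ∀ (k m t : ℕ) (f : Fin k → Fin m → ℝ[X]), k ≤ 2 ^ m →
    (∀ i j, (f i j).support.card ≤ t) → (∑ i, ∏ j, f i j) ≠ 0 →
      (∑ i, ∏ j, f i j).roots.toFinset.card ≤ (k + m + t + 2) ^ c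

/-- **The few-products regime IS the crux** (pad `m` with `k` unit factors: `k ≤ 2^(m+k)`).
So no regime split along `k` versus `2^m` decomposes `TauReal`. [folklore] -/
theorem tauReal_iff_fewProducts : TauReal ↔ FewProductsTauReal := by
  constructor
  · rintro ⟨c, hc⟩
    exact ⟨c, fun k m t f _ hf hF => hc k m t f hf hF⟩
  · intro h
    refine tauReal_of_cofinal (fun k m _ => k ≤ 2 ^ m) 2 ?_ ?_
    · intro k m t _ _
      refine ⟨0, k, t, ?_, le_rfl, by nlinarith⟩
      calc k + 0 = k := by omega
        _ ≤ 2 ^ k := Nat.lt_two_pow_self.le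
        _ ≤ 2 ^ (m + k) := Nat.pow_le_pow_right (by norm_num) (by omega)
    · obtain ⟨c, hc⟩ := h
      exact ⟨c, fun k m t f hR hf hF => hc k m t f hR hf hF⟩

/-! ## §3 The weak form is the many-products regime -/

/-- The crux restricted to the **many-products regime** `2^m ≤ k`. [folklore] -/
def ManyProductsTauReal : Prop :=
  ∃ c : ℕ, ∀ (k m t : ℕ) (f : Fin k → Fin m → ℝ[X]), 2 ^ m ≤ k →
    (∀ i j, (f i j).support.card ≤ t) → (∑ i, ∏ j, f i j) ≠ 0 →
      (∑ i, ∏ j, f i j).roots.toFinset.card ≤ (k + m + t + 2) ^ c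

/-- **`RealTauRefined` is exactly the many-products regime of the polynomial crux.**
(`⇒`: `2^{a(m+1)} ≤ (2k)^a` when `2^m ≤ k`; `⇐`: pad `k` with `2^m` zero products, then
`k + 2^m + m + t + 2 ≤ 2^{m+1}(k + t + 2)`.) [folklore] -/
theorem realTauRefined_iff_manyProducts : RealTauRefined ↔ ManyProductsTauReal := by
  constructor
  · rintro ⟨a, ha⟩
    refine ⟨3 * a, fun k m t f hk hf hF => (ha k m t f hf hF).trans ?_⟩
    have hb : 2 ^ (m + 1) ≤ (k + m + t + 2) ^ 2 := by
      have h2 : 2 ^ (m + 1) ≤ 2 * (k + m + t + 2) := by rw [pow_succ]; omega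
      calc 2 ^ (m + 1) ≤ 2 * (k + m + t + 2) := h2
        _ ≤ (k + m + t + 2) * (k + m + t + 2) := Nat.mul_le_mul_right _ (by omega)
        _ = (k + m + t + 2) ^ 2 := (pow_two _).symm
    have h1 : 2 ^ (a * (m + 1)) ≤ (k + m + t + 2) ^ (2 * a) := by
      rw [mul_comm a, pow_mul, pow_mul]
      exact Nat.pow_le_pow_left hb a
    have h2 : (k + t + 2) ^ a ≤ (k + m + t + 2) ^ a := Nat.pow_le_pow_left (by omega) a
    calc 2 ^ (a * (m + 1)) * (k + t + 2) ^ a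
        ≤ (k + m + t + 2) ^ (2 * a) * (k + m + t + 2) ^ a := Nat.mul_le_mul h1 h2
      _ = (k + m + t + 2) ^ (3 * a) := by rw [← pow_add]; ring_nf
  · rintro ⟨c, hc⟩
    refine ⟨c, fun k m t f hf hF => ?_⟩
    rcases Nat.eq_zero_or_pos m with hm | hm
    · rw [card_roots_eq_zero_of_degenerate f hf hF (Or.inl hm)]; exact Nat.zero_le _
    rcases Nat.eq_zero_or_pos t with ht | ht
    · rw [card_roots_eq_zero_of_degenerate f hf hF (Or.inr ht)]; exact Nat.zero_le _
    have hf' : ∀ i j, (pad (2 ^ m) 0 f i j).support.card ≤ t := card_support_pad _ _ ht f hf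
    have hsum := sum_prod_pad (2 ^ m) 0 (by omega) f
    have h := hc (k + 2 ^ m) (m + 0) t (pad (2 ^ m) 0 f) (by simp) hf' (by rwa [hsum])
    rw [hsum] at h
    refine h.trans ?_
    have hbase : k + 2 ^ m + (m + 0) + t + 2 ≤ 2 ^ (m + 1) * (k + t + 2) := by
      have hm2 : m ≤ 2 ^ m := Nat.lt_two_pow_self.le
      have h1 : 1 ≤ 2 ^ m := Nat.one_le_two_pow
      rw [pow_succ]
      nlinarith
    calc (k + 2 ^ m + (m + 0) + t + 2) ^ c ≤ (2 ^ (m + 1) * (k + t + 2)) ^ c :=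
          Nat.pow_le_pow_left hbase c
      _ = 2 ^ (c * (m + 1)) * (k + t + 2) ^ c := by rw [mul_pow, ← pow_mul, mul_comm (m + 1) c]

/-- Hence the polynomial crux is `RealTauRefined` PLUS `m`-uniformity for few products:
`TauReal ↔ ManyProductsTauReal ∧ FewProductsTauReal`, where the second conjunct is already an
alias of the crux (`tauReal_iff_fewProducts`) — the split is degenerate. [folklore] -/
theorem tauReal_iff_regimes : TauReal ↔ ManyProductsTauReal ∧ FewProductsTauReal := by
  constructor
  · intro h
    refine ⟨?_, tauReal_iff_fewProducts.mp h⟩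
    obtain ⟨c, hc⟩ := h
    exact ⟨c, fun k m t f _ hf hF => hc k m t f hf hF⟩
  · exact fun h => tauReal_iff_fewProducts.mpr h.2

/-- Koiran's form implies Tavenas' weak form (the route's support item `OfKoiran`; same proof as
`Cruxes/RealTauRefined/Disproof.lean`, `realTauRefined_of_tauReal`), recorded here so that this
file is self-contained: `(k+m+t+2)^c ≤ 2^{c(m+1)}(k+t+2)^c`. [cite: Tavenas2014, Conj. 3.23] -/
theorem realTauRefined_of_tauReal' (h : TauReal) : RealTauRefined := by
  obtain ⟨c, hc⟩ := h
  refine ⟨c, fun k m t f hf hF => (hc k m t f hf hF).trans ?_⟩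
  have h1 : k + m + t + 2 ≤ 2 ^ (m + 1) * (k + t + 2) :=
    calc k + m + t + 2 ≤ (m + 1 + 1) * (k + t + 2) := by nlinarith
      _ ≤ 2 ^ (m + 1) * (k + t + 2) := Nat.mul_le_mul_right _ Nat.lt_two_pow_self
  calc (k + m + t + 2) ^ c ≤ (2 ^ (m + 1) * (k + t + 2)) ^ c := Nat.pow_le_pow_left h1 c
    _ = 2 ^ (c * (m + 1)) * (k + t + 2) ^ c := by rw [mul_pow, ← pow_mul, mul_comm (m + 1) c]

/-! ## §4 Typed candidates of the census (statements only) -/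

/-- Positive-zeros normal form (count zeros in `(0, ∞)` only; `x ↦ -x` preserves the shape and
`0` is one point). [folklore] -/
def PosTauReal : Prop :=
  ∃ c : ℕ, ∀ (k m t : ℕ) (f : Fin k → Fin m → ℝ[X]), (∀ i j, (f i j).support.card ≤ t) →
    (∑ i, ∏ j, f i j) ≠ 0 →
      ((∑ i, ∏ j, f i j).roots.toFinset.filter (fun x => 0 < x)).card ≤ (k + m + t + 2) ^ c

/-- RUNG (negation / calibration target; implied by the crux with `k = t = 2`, not known):
two products of `m` real binomials have polynomially many (in `m`) distinct real zeros.
Descartes gives `2^{m+2} - 1`; nothing better is in print (Koiran 2011 §6: "the case k = 2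
already looks nontrivial"). [conjecture] -/
def TwoProductsOfBinomials : Prop :=
  ∃ c : ℕ, ∀ (m : ℕ) (f g : Fin m → ℝ[X]), (∀ j, (f j).support.card ≤ 2) →
    (∀ j, (g j).support.card ≤ 2) → (∏ j, f j + ∏ j, g j) ≠ 0 →
      (∏ j, f j + ∏ j, g j).roots.toFinset.card ≤ (m + 2) ^ c

/-- The rung follows from the crux (instance `k = 2`, `t = 2`; `(m + 6)^c ≤ (m + 2)^{3c}`).
[folklore] -/
theorem twoProductsOfBinomials_of_tauReal (h : TauReal) : TwoProductsOfBinomials := by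
  obtain ⟨c, hc⟩ := h
  refine ⟨3 * c, fun m f g hf hg hF => ?_⟩
  have key : (∑ i : Fin 2, ∏ j, (![f, g] : Fin 2 → Fin m → ℝ[X]) i j) = ∏ j, f j + ∏ j, g j := by
    simp [Fin.sum_univ_two]
  have hsp : ∀ (i : Fin 2) (j : Fin m), ((![f, g] : Fin 2 → Fin m → ℝ[X]) i j).support.card ≤ 2 := by
    intro i j
    fin_cases i
    · exact hf j
    · exact hg j
  have h := hc 2 m 2 ![f, g] hsp (by rw [key]; exact hF)
  rw [key] at h
  refine h.trans ?_
  have h3 : 2 + m + 2 + 2 ≤ (m + 2) ^ 3 := by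
    have : (m + 2) ^ 3 = m ^ 3 + 6 * m ^ 2 + 12 * m + 8 := by ring
    rw [this]; omega
  calc (2 + m + 2 + 2) ^ c ≤ ((m + 2) ^ 3) ^ c := Nat.pow_le_pow_left h3 c
    _ = (m + 2) ^ (3 * c) := by rw [← pow_mul]

/-- The `k = 2` Rolle object: zeros of the Wronskian `W(P, Q) = P Q' - P' Q` of two products of
`m` `t`-sparse polynomials (critical points of `P/Q`) are polynomially bounded in `m, t`.
Implied by the crux (`W(∏ f, ∏ g)` is a ΣΠ-sparse expression of shape `(2m, 2m, t)` by the
Leibniz rule); for `m = 1` it is Descartes (`≤ 2t²` monomials); open for growing `m`.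
[conjecture] -/
def WronskianPairBound : Prop :=
  ∃ c : ℕ, ∀ (m t : ℕ) (f g : Fin m → ℝ[X]), (∀ j, (f j).support.card ≤ t) →
    (∀ j, (g j).support.card ≤ t) → Polynomial.wronskian (∏ j, f j) (∏ j, g j) ≠ 0 →
      (Polynomial.wronskian (∏ j, f j) (∏ j, g j)).roots.toFinset.card ≤ (m + t + 2) ^ c

/-- The iterated Wronskian `W(P_0, …, P_{i-1}) = det (P_l^{(r)})` of the first `i` of `k`
polynomials (tree `Literature.LinearAlgebra.Matrix.wronskian` with `D = d/dX`). [folklore] -/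
def wr {k : ℕ} (P : Fin k → ℝ[X]) (i : ℕ) (hi : i ≤ k) : ℝ[X] :=
  Literature.LinearAlgebra.Matrix.wronskian (fun p : ℝ[X] => derivative p)
    (fun l : Fin i => P (Fin.castLE hi l))

/-- FIRST LEMMA of the Wronskian transfer (Voorhoeve–van der Poorten; KPT15 Thm 8, polynomial
case): for linearly independent real polynomials `P_0, …, P_{k-1}`,
`#Z(∑ P_l) ≤ (1 + ∑_{i ≤ k} #Z(W(P_0, …, P_{i-1}))) · k`.  A theorem in print (provable, size L:
Rolle + `W(f_1..f_i)/f_1^i = W((f_2/f_1)', …)`); stated here for products of sparse factors, the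
shape in which the census uses it. [cite: KoiranPortierTavenas2015, Thm 8] -/
def VdPForProducts : Prop :=
  ∀ (k m : ℕ) (f : Fin k → Fin m → ℝ[X]),
    LinearIndependent ℝ (fun i => ∏ j, f i j) →
      (∑ i, ∏ j, f i j).roots.toFinset.card ≤
        (1 + ∑ i ∈ Finset.range (k + 1),
          if hi : i ≤ k then (wr (fun l => ∏ j, f l j) i hi).roots.toFinset.card else 0) * k

/-- SUB-CRUX of the log-scale window decomposition ("flat window"): all coefficients of all
factors have modulus in `[e^{-s}, e^{s}]`, `s = k + m + t + 2`, and only zeros in the window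
`(e^{-1}, e)` are counted.  Implied by the crux; contains every instance in which all factors
switch their dominant monomial at the same scale; not known to be easier. [conjecture] -/
def FlatWindowTauReal : Prop :=
  ∃ c : ℕ, ∀ (k m t : ℕ) (f : Fin k → Fin m → ℝ[X]), (∀ i j, (f i j).support.card ≤ t) →
    (∀ i j, ∀ n ∈ (f i j).support, abs (Real.log (abs ((f i j).coeff n))) ≤ (k + m + t + 2 : ℝ)) →
    (∑ i, ∏ j, f i j) ≠ 0 →
      ((∑ i, ∏ j, f i j).roots.toFinset.filter
        (fun x => Real.exp (-1) < x ∧ x < Real.exp 1)).card ≤ (k + m + t + 2) ^ c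

/-- Hrubeš's SECTOR FORM (ToC 2013, Conj. 2.2; EQUIVALENT to the crux by his Thm 2.3): the
arguments of the complex roots of a ΣΠ-sparse `F` with `F(0) ≠ 0` are equidistributed in every
sector up to an error polynomial in `k, m, t` (roots counted with multiplicity).
[cite: Hrubes2013, Conj. 2.2 and Thm. 2.3] -/
def HrubesSector : Prop :=
  ∃ c : ℕ, ∀ (k m t : ℕ) (f : Fin k → Fin m → ℝ[X]), (∀ i j, (f i j).support.card ≤ t) →
    (∑ i, ∏ j, f i j).coeff 0 ≠ 0 → ∀ α β : ℝ, -Real.pi < β → β < α → α ≤ Real.pi →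
      abs (((((∑ i, ∏ j, f i j).map (algebraMap ℝ ℂ)).roots.countP
            (fun z => β < Complex.arg z ∧ Complex.arg z < α) : ℕ) : ℝ)
        - (α - β) * ((∑ i, ∏ j, f i j).natDegree : ℝ) / (2 * Real.pi)) ≤ (k + m + t + 2 : ℝ) ^ c

end

end Summit.ValiantsHypothesis.ValiantsHypothesis.Cruxes.TauReal.Strategist
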